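import Literature.AlgebraicGeometry.HodgeTheory.QuaternionicQuarticGenericModel
import Literature.AlgebraicGeometry.HodgeTheory.QuaternionicQuarticFamilyDeckOfGenericModel
import Literature.AlgebraicGeometry.HodgeTheory.QuaternionicQuarticFamilyDeckBirationalOfGenericModel
import Literature.AlgebraicGeometry.Resolution.EquivariantRegularProjectiveCompletion
import HarnessLib

/-!
# The generic smooth projective `Q₈`-model and the deck family, UNCONDITIONALLY (programme «M1», Kollár-free)

Layer `Literature/AlgebraicGeometry/HodgeTheory`. Theorems only (no definition, no named fact, NO hypothesis). Route
`HodgeConjecture/Q8SymplecticPowers` (crux K1Q, stmt-HodgeConjecture-24190), programme M1 ∕ target P-3′ «Kollár-free deck family»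
of the hands' census (FIFTH-HAND-AUDIT-leafhand4-g1, P3PRIME-BRICKS-leafhand4-g2): the brick `exists_genericModel`
(`QuaternionicQuarticGenericModel.lean`) and everything downstream of it (`q8FamilyDeck_holds`, `q8FamilyDeck_birational`) were
CONDITIONAL on the all-dimension named fact `Resolution.Kollar2007_resolutionLiftsAutomorphisms` (Kollár 2007 Thm. 3.36 + §3.4.1).
Here the same conclusions are proved outright:

* `exists_genericModel_holds` — for `e ≥ 2`, a smooth projective geometrically irreducible surface `E` over `K = Frac ℂ[a]` with a
  `Q₈`-action and a `Q₈`-equivariant open immersion of the generic étale chart `genericChart e K ↪ E`. Proof = the proof of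
  `exists_genericModel_of_surfaceLifting` with its two inputs (equivariant projective completion; equivariant resolution, iso over
  the regular chart) supplied at once by `Resolution.exists_equivariant_completion_resolution`: the chart is embedded
  EQUIVARIANTLY into `ℙⁿ_K` with a linear (permutation) `Q₈`-action (`G`-stable generators, Mumford AV §7), closed up with its
  reduced structure, and resolved by the tree's PROVED embedded equivariant strong resolution
  (`Kollar2007.exists_equivariant_isResolution_isProjectiveOver_isIso_proj`, Kollár 3.36 (1)(2)(4) for ONE resolution).
* `q8FamilyDeck_holds'` — `Q8FamilyDeck e` for every `e ≥ 2` (`q8FamilyDeck_of_genericModel`), i.e. the smooth projective FAMILY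
  model over a non-empty open of the parameter space carrying the deck pair `(τ, j)` — the ∃-prefix of the K1Q certificate stubs.
* `q8FamilyDeck_birational_holds'` — `Q8FamilyDeckBirational e` for every `e ≥ 2` (`q8FamilyDeck_birational_of_genericModel`).

Honest scope: existence of the deck family; the local certificates, S1, K1Q and HC are NOT proved here.

## References

* [Kollar2007] J. Kollár, Lectures on Resolution of Singularities (2007), Thm. 3.36 (1)(2)(4), §3.4.1 (p. 121).
* [DeJong1996] A. J. de Jong, Smoothness, semi-stability and alterations (1996), 4.17.
* [EGAIV3] A. Grothendieck, J. Dieudonné, EGA IV₃ (1966), Thm. 8.10.5.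
* [GortzWedhorn2020] U. Görtz, T. Wedhorn, Algebraic Geometry I, 2nd ed. (2020), Prop. 4.32 (2).
-/

noncomputable section

open CategoryTheory CategoryTheory.Limits AlgebraicGeometry TopologicalSpace

namespace Literature.AlgebraicGeometry.HodgeTheory.Q8Family

open Literature.AlgebraicGeometry.Motives Literature.AlgebraicGeometry.RelativeSpec
  Literature.AlgebraicGeometry.Resolution

variable (e : ℕ)

/-- **The generic smooth projective `Q₈`-model, unconditionally.** For `e ≥ 2` there are a smooth projective geometrically
irreducible `K`-surface `E` (`K = Frac ℂ[a]`) with an action of `Q₈` over `K` and a `Q₈`-equivariant open immersion of the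
generic étale chart `genericChart e K ↪ E` over `K` — the conclusion of `exists_genericModel` WITHOUT Kollár's named fact:
the equivariant projective completion is taken inside `ℙⁿ_K` with a linear `Q₈`-action and resolved by the tree's proved
equivariant strong resolution (`Resolution.exists_equivariant_completion_resolution`); the rest of the proof is that of
`exists_genericModel_of_surfaceLifting`. [cite: Kollar2007, Thm. 3.36 and §3.4.1 (p. 121)] [cite: DeJong1996, 4.17, p. 72] -/
theorem exists_genericModel_holds (he : 2 ≤ e) :
    ∃ (E : SchemeOver (FractionRing (ParamRing e))) (ρE : ActionOver E.hom (QuaternionGroup 2))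
      (θ : genericChart e (FractionRing (ParamRing e)) ⟶ E),
      IsSmoothProjective 2 E ∧ IsOpenImmersion θ.left ∧
      ∀ g : QuaternionGroup 2,
        ((genericAction e (FractionRing (ParamRing e))).aut g).hom ≫ θ.left = θ.left ≫ (ρE.aut g).hom := by
  set K : Type := FractionRing (ParamRing e) with hK
  haveI : CharZero K := charZero_of_injective_algebraMap (IsFractionRing.injective (ParamRing e) K)
  let U : SchemeOver K := genericChart e K
  let ρU : ActionOver U.hom (QuaternionGroup 2) := genericAction e K
  haveI : IsAffine U.left := isAffine_genericChart e K
  haveI : IsIntegral U.left := isIntegral_genericChart e K he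
  haveI : LocallyOfFiniteType U.hom := locallyOfFiniteType_genericChart e K
  haveI : SmoothOfRelativeDimension 2 U.hom := smoothOfRelativeDimension_genericChart e K
  haveI : GeometricallyIrreducible U.hom := geometricallyIrreducible_genericChart e K he
  have hUreg : Scheme.IsRegular U.left := isRegular_genericChart e K
  -- ### (1)+(2) equivariant projective completion `ι : U ↪ N` WITH an equivariant resolution `r : Y → N`, iso over `ι(U)`
  obtain ⟨N, hNint, ρN, ι, Y, r, ρY, hNproj, hιopen, hιeq, hr, hYproj, ⟨V, hV, hisoV⟩, hYeq⟩ :=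
    exists_equivariant_completion_resolution U (fun x => hUreg x) ρU
  haveI := hNint
  haveI := hιopen
  haveI : IsProper N.hom := IsProjectiveOver.isProper hNproj
  haveI : IsLocallyNoetherian N.left := LocallyOfFiniteType.isLocallyNoetherian N.hom
  have hVeq : V = ι.left.opensRange := Opens.ext (hV.trans (Scheme.Hom.coe_opensRange ι.left).symm)
  subst hVeq
  -- `N` is geometrically irreducible: `U ≅ V` is a dense open
  have hUV : U.hom = (ι.left.isoOpensRange.hom ≫ ι.left.opensRange.ι) ≫ N.hom := by
    rw [Scheme.Hom.isoOpensRange_hom_ι, Over.w ι]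
  haveI : GeometricallyIrreducible (ι.left.opensRange.ι ≫ N.hom) := by
    have hgi : GeometricallyIrreducible ((ι.left.isoOpensRange.hom ≫ ι.left.opensRange.ι) ≫ N.hom) := by
      rw [← hUV]; infer_instance
    rw [Category.assoc] at hgi
    exact (MorphismProperty.cancel_left_of_respectsIso @GeometricallyIrreducible _ _).mp hgi
  have hVdense : Dense (ι.left.opensRange : Set N.left) := by
    obtain ⟨u⟩ := (inferInstance : Nonempty U.left)
    exact ι.left.opensRange.2.dense ⟨ι.left u, ⟨u, rfl⟩⟩
  haveI : GeometricallyIrreducible N.hom := geometricallyIrreducible_of_dense_opens N.hom _ hVdense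
  -- `dim N = dim U = 2`
  have hdimU : topologicalKrullDim U.left = (2 : ℕ) := topologicalKrullDim_eq_of_smoothOfRelativeDimension U.hom 2
  have hdimUN : topologicalKrullDim U.left = topologicalKrullDim N.left :=
    topologicalKrullDim_eq_of_isOpenImmersion N.hom ι.left
  have hdimN : topologicalKrullDim N.left = (2 : ℕ) := hdimUN.symm.trans hdimU
  -- ### the resolution `Y` is a smooth projective geometrically irreducible surface
  let E : SchemeOver K := Over.mk (r ≫ N.hom)
  haveI : IsProper E.hom := IsProjectiveOver.isProper hYproj
  haveI : IsProper (r ≫ N.hom) := inferInstanceAs (IsProper E.hom)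
  haveI : Smooth (r ≫ N.hom) := smooth_of_isRegular_of_perfectField _ hr.isRegular
  have hgiY : GeometricallyIrreducible (r ≫ N.hom) := geometricallyIrreducible_of_isResolution N.hom hr
  haveI : IrreducibleSpace Y := hr.isBirational.irreducibleSpace
  obtain ⟨d, hd⟩ := exists_smoothOfRelativeDimension_of_smooth (r ≫ N.hom)
  haveI := hd
  have hdimYN : topologicalKrullDim Y = topologicalKrullDim N.left := hr.topologicalKrullDim_eq
  have hdimY : topologicalKrullDim Y = (d : ℕ) := topologicalKrullDim_eq_of_smoothOfRelativeDimension (r ≫ N.hom) d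
  have hd2 : d = 2 := by
    have h1 : ((d : ℕ∞) : WithBot ℕ∞) = ((2 : ℕ) : ℕ∞) := by
      exact hdimY.symm.trans (hdimYN.trans hdimN)
    exact_mod_cast h1
  subst hd2
  have hE : IsSmoothProjective 2 E := ⟨hd, hYproj, hgiY⟩
  -- ### (3) the lift `θ : U ↪ Y` of `ι` (`r` is an isomorphism over `ι(U)`)
  let θl : U.left ⟶ Y := ι.left.isoOpensRange.hom ≫ inv (r ∣_ ι.left.opensRange) ≫ (r ⁻¹ᵁ ι.left.opensRange).ι
  have hθr : θl ≫ r = ι.left := by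
    change (ι.left.isoOpensRange.hom ≫ inv (r ∣_ ι.left.opensRange) ≫ (r ⁻¹ᵁ ι.left.opensRange).ι) ≫ r = ι.left
    rw [Category.assoc, Category.assoc, ← morphismRestrict_ι, IsIso.inv_hom_id_assoc, Scheme.Hom.isoOpensRange_hom_ι]
  have hθw : θl ≫ E.hom = U.hom := by
    change θl ≫ r ≫ N.hom = U.hom
    rw [← Category.assoc, hθr, Over.w ι]
  let θ : U ⟶ E := Over.homMk θl hθw
  haveI : IsOpenImmersion θl := inferInstance
  refine ⟨E, ρY, θ, hE, inferInstanceAs (IsOpenImmersion θl), fun g => ?_⟩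
  -- ### (4) equivariance
  change (ρU.aut g).hom ≫ θl = θl ≫ (ρY.aut g).hom
  have hc : ((ρU.aut g).hom ≫ θl) ≫ r = ι.left ≫ (ρN.aut g).hom := by
    rw [Category.assoc, hθr]; exact hιeq g
  have hc' : (θl ≫ (ρY.aut g).hom) ≫ r = ι.left ≫ (ρN.aut g).hom := by
    rw [Category.assoc, hYeq g, ← Category.assoc, hθr]
  have hrange : ∀ u : U.left, (ι.left ≫ (ρN.aut g).hom) u ∈ ι.left.opensRange := fun u => by
    rw [← hιeq g, Scheme.Hom.comp_apply]
    exact ⟨_, rfl⟩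
  refine eq_of_comp_eq_of_range_subset r ι.left.opensRange (hc.trans hc'.symm) (fun u => ?_) (fun u => ?_)
  · rw [← Scheme.Hom.comp_apply, hc]; exact hrange u
  · rw [← Scheme.Hom.comp_apply, hc']; exact hrange u

/-- **`Q8FamilyDeck e` holds unconditionally** (`e ≥ 2`): the smooth projective FAMILY model of the quaternionic quartic
multiple planes over a non-empty open of the parameter space, carrying the deck pair `(τ, j)` with the quaternion relations
and the equivariant open immersion of the explicit étale chart (programme M1 = the ∃-prefix of the K1Q certificate stubs of
route `HodgeConjecture/Q8SymplecticPowers`) — `q8FamilyDeck_of_genericModel` fed with `exists_genericModel_holds`; compare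
`q8FamilyDeck_holds`, which assumed Kollár's named fact. [cite: Kollar2007, Thm. 3.36 and §3.4.1] [cite: EGAIV3, Thm. 8.10.5] -/
theorem q8FamilyDeck_holds' (he : 2 ≤ e) : Q8FamilyDeck e :=
  q8FamilyDeck_of_genericModel e he (exists_genericModel_holds e he)

/-- **`Q8FamilyDeckBirational e` holds unconditionally** (`e ≥ 2`): the deck family together with the fibrewise
birationality to the quartic hypersurfaces `V_(c,ψ)` (`q8FamilyDeck_birational_of_genericModel` fed with
`exists_genericModel_holds`; compare `q8FamilyDeck_birational`, which assumed Kollár's named fact).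
[cite: Kollar2007, Thm. 3.36 and §3.4.1] [cite: GortzWedhorn2020, Prop. 4.32 (2)] -/
theorem q8FamilyDeck_birational_holds' (he : 2 ≤ e) : Q8FamilyDeckBirational e :=
  q8FamilyDeck_birational_of_genericModel e he (exists_genericModel_holds e he)

end Literature.AlgebraicGeometry.HodgeTheory.Q8Family

end
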